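import Summits.QuantumFields.YangMills.Theorems.AllWindowsColdBoxBoxHighLineGaussianHypercontractivityPoly
import Summits.QuantumFields.YangMills.Theorems.AllWindowsColdBoxBoxHighLineGaussianChartWickIntegrable

/-!
# «Polynomial observables are integrable against the chart Gaussian» — `∫ |Q(v)| e^{−β vᵀPv} dv < ∞` for every `MvPolynomial` `Q`

Tool for the Wick layer / assembly of STEP 2 of the XL stub S5 (LINE-19 ⟨stmt-QuantumFields-24004⟩/⟨24335⟩; planner ym-idea-2 g18's
`ASSEMBLY-S5.md` §6: every Cauchy–Schwarz / `integral_mono` step needs integrability of a polynomial dominator times the Gaussian weight).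
In the letters of ✓`GaussianChartWickFintype` (`[Fintype ι] [DecidableEq ι]`, `P : Matrix ι ι ℝ` positive definite, `0 < β`):

* `Hypercontractivity.integrable_eval_mul_exp` — `v ↦ Q(v)·exp(−β‖Mv‖²)` is Lebesgue-integrable (`det M ≠ 0`): ✓`integrable_mul_exp_iff` (LEAD) moves to
  `P_β = ⊗ N(0,(2β)⁻¹)`, ✓`measurePreserving_scale_pi_gaussianReal` to `⊗ N(0,1)`, where ✓`integrable_eval_mulVec_pi` (polynomials of a linear image
  of a standard Gaussian vector) applies;
* `Hypercontractivity.integrable_eval_mul_exp_quadForm` / **`…_quadForm'`** — the same against `exp(−β vᵀPv)` on `Fin n → ℝ` / on `ι → ℝ`;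
* **`Hypercontractivity.integrable_mul_exp_quadForm_of_polyDeg`** — for an observable `F : (ι → ℝ) → ℝ` certified polynomial
  (`∃ Q, Q.totalDegree ≤ d ∧ ∀ v, F v = eval v Q`, the hypothesis shape of ✓`…GaussianHypercontractivityPoly`), and the products / powers
  `integrable_sq_mul_exp_quadForm_of_polyDeg`, `integrable_pow_mul_exp_quadForm_of_polyDeg`, `integrable_mul_mul_exp_quadForm_of_polyDeg`.

Tree + Mathlib only; no definitions.  HONEST LABEL: a measure-theoretic tool for STEP 2 of the XL stub S5 of a critic-PASSed DRAFT line; S5, U5,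
⟨stmt-QuantumFields-24004⟩ ⟨24335⟩ ⟨24336⟩ remain OPEN; route AllWindowsColdBox is DRAFT; **the Yang–Mills mass gap is NOT proved by this file; no summit
is proved by a line.**  Seat ym-line-sfw-p2-w5 g22 (EXTRA WIDTH seat w5, cell ym-idea-1).
-/

set_option autoImplicit false

noncomputable section

open MeasureTheory ProbabilityTheory Matrix Finset
open scoped NNReal ENNReal
open Literature.Probability.Distributions

namespace Summit.QuantumFields.YangMills.Theorems.AllWindowsColdBoxBoxHighLine

namespace Hypercontractivity

/-! ## `Fin n`: the weight `exp(−β‖Mv‖²)` and `exp(−β vᵀPv)` -/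

section FinN

variable {n : ℕ}

/-- **A polynomial times `exp(−β‖Mv‖²)` is Lebesgue-integrable** (`det M ≠ 0`, `β > 0`). -/
theorem integrable_eval_mul_exp (M : Matrix (Fin n) (Fin n) ℝ) (hM : M.det ≠ 0) {β : ℝ} (hβ : 0 < β)
    (Q : MvPolynomial (Fin n) ℝ) :
    Integrable (fun v : Fin n → ℝ => MvPolynomial.eval v Q * Real.exp (-(β * (M *ᵥ v ⬝ᵥ M *ᵥ v)))) := by
  rw [GaussianChartWick.integrable_mul_exp_iff M hM hβ]
  have hmp := measurePreserving_scale_pi_gaussianReal (ι := Fin n) (Real.toNNReal (2 * β)⁻¹) (GaussianChartWick.var_ne_zero hβ)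
  rw [← hmp.integrable_comp_emb (MeasurableEquiv.measurableEmbedding _)]
  refine (integrable_eval_mulVec_pi (Real.sqrt (2 * β)⁻¹ • M⁻¹) Q).congr (Filter.Eventually.of_forall fun z => ?_)
  simp only [Function.comp_apply, coe_piCongrRight_mulLeft₀, sqrt_coe_var hβ]
  congr 1
  have hz : (fun i => Real.sqrt (2 * β)⁻¹ * z i) = Real.sqrt (2 * β)⁻¹ • z := rfl
  rw [hz, Matrix.mulVec_smul, Matrix.smul_mulVec]

/-- **A polynomial times `exp(−β vᵀPv)` is Lebesgue-integrable** (`P` positive definite on `Fin n`, `β > 0`). -/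
theorem integrable_eval_mul_exp_quadForm (P : Matrix (Fin n) (Fin n) ℝ) (hP : P.PosDef) {β : ℝ} (hβ : 0 < β)
    (Q : MvPolynomial (Fin n) ℝ) :
    Integrable (fun v : Fin n → ℝ => MvPolynomial.eval v Q * Real.exp (-(β * (v ⬝ᵥ P *ᵥ v)))) := by
  obtain ⟨M, hMP, hM⟩ := GaussianChartWick.exists_transpose_mul_self_of_posDef P hP
  have h := integrable_eval_mul_exp M hM hβ Q
  simpa only [GaussianChartWick.mulVec_dotProduct_mulVec_of_transpose_mul_self hMP] using h

end FinN

/-! ## Any finite index type `ι` -/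

section Fintype

variable {ι : Type*} [Fintype ι]

/-- **A polynomial times `exp(−β vᵀPv)` is Lebesgue-integrable over `ι → ℝ`** (`P` positive definite, `β > 0`). -/
theorem integrable_eval_mul_exp_quadForm' (P : Matrix ι ι ℝ) (hP : P.PosDef) {β : ℝ} (hβ : 0 < β) (Q : MvPolynomial ι ℝ) :
    Integrable (fun v : ι → ℝ => MvPolynomial.eval v Q * Real.exp (-(β * (v ⬝ᵥ P *ᵥ v)))) := by
  have hmp := volume_measurePreserving_piCongrLeft (fun _ : ι => ℝ) (Fintype.equivFin ι).symm
  have h := integrable_eval_mul_exp_quadForm _ (posDef_submatrix_equivFin P hP) hβ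
    (MvPolynomial.rename (Fintype.equivFin ι) Q)
  rw [← hmp.integrable_comp_emb (MeasurableEquiv.measurableEmbedding _)]
  have hfun : ((fun v : ι → ℝ => MvPolynomial.eval v Q * Real.exp (-(β * (v ⬝ᵥ P *ᵥ v)))) ∘
      (MeasurableEquiv.piCongrLeft (fun _ : ι => ℝ) (Fintype.equivFin ι).symm)) =
      fun w => MvPolynomial.eval w (MvPolynomial.rename (Fintype.equivFin ι) Q) *
        Real.exp (-(β * (w ⬝ᵥ (P.submatrix (Fintype.equivFin ι).symm (Fintype.equivFin ι).symm) *ᵥ w))) := by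
    funext w
    have hw : (MeasurableEquiv.piCongrLeft (fun _ : ι => ℝ) (Fintype.equivFin ι).symm w) = fun i => w (Fintype.equivFin ι i) := by
      funext i; exact GaussianChartWick.piCongrLeft_equivFin_symm_apply w i
    simp only [Function.comp_apply, hw, quadForm_comp_equivFin, eval_comp_equivFin]
  rw [hfun]
  exact h

/-- **A certified-polynomial observable times `exp(−β vᵀPv)` is integrable.** -/
theorem integrable_mul_exp_quadForm_of_polyDeg (P : Matrix ι ι ℝ) (hP : P.PosDef) {β : ℝ} (hβ : 0 < β)
    {F : (ι → ℝ) → ℝ} {d : ℕ} (hF : ∃ Q : MvPolynomial ι ℝ, Q.totalDegree ≤ d ∧ ∀ v, F v = MvPolynomial.eval v Q) :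
    Integrable (fun v : ι → ℝ => F v * Real.exp (-(β * (v ⬝ᵥ P *ᵥ v)))) := by
  obtain ⟨Q, -, hFQ⟩ := hF
  simp only [hFQ]
  exact integrable_eval_mul_exp_quadForm' P hP hβ Q

/-- Powers of a certified-polynomial observable against the weight are integrable. -/
theorem integrable_pow_mul_exp_quadForm_of_polyDeg (P : Matrix ι ι ℝ) (hP : P.PosDef) {β : ℝ} (hβ : 0 < β)
    {F : (ι → ℝ) → ℝ} {d : ℕ} (hF : ∃ Q : MvPolynomial ι ℝ, Q.totalDegree ≤ d ∧ ∀ v, F v = MvPolynomial.eval v Q) (k : ℕ) :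
    Integrable (fun v : ι → ℝ => F v ^ k * Real.exp (-(β * (v ⬝ᵥ P *ᵥ v)))) :=
  integrable_mul_exp_quadForm_of_polyDeg P hP hβ (polyDeg_pow hF k)

/-- Squares of a certified-polynomial observable against the weight are integrable. -/
theorem integrable_sq_mul_exp_quadForm_of_polyDeg (P : Matrix ι ι ℝ) (hP : P.PosDef) {β : ℝ} (hβ : 0 < β)
    {F : (ι → ℝ) → ℝ} {d : ℕ} (hF : ∃ Q : MvPolynomial ι ℝ, Q.totalDegree ≤ d ∧ ∀ v, F v = MvPolynomial.eval v Q) :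
    Integrable (fun v : ι → ℝ => F v ^ 2 * Real.exp (-(β * (v ⬝ᵥ P *ᵥ v)))) :=
  integrable_pow_mul_exp_quadForm_of_polyDeg P hP hβ hF 2

/-- Products of two certified-polynomial observables against the weight are integrable. -/
theorem integrable_mul_mul_exp_quadForm_of_polyDeg (P : Matrix ι ι ℝ) (hP : P.PosDef) {β : ℝ} (hβ : 0 < β)
    {F G : (ι → ℝ) → ℝ} {p q : ℕ}
    (hF : ∃ Q : MvPolynomial ι ℝ, Q.totalDegree ≤ p ∧ ∀ v, F v = MvPolynomial.eval v Q)
    (hG : ∃ Q : MvPolynomial ι ℝ, Q.totalDegree ≤ q ∧ ∀ v, G v = MvPolynomial.eval v Q) :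
    Integrable (fun v : ι → ℝ => F v * G v * Real.exp (-(β * (v ⬝ᵥ P *ᵥ v)))) :=
  integrable_mul_exp_quadForm_of_polyDeg P hP hβ (polyDeg_mul hF hG)

end Fintype

end Hypercontractivity

end Summit.QuantumFields.YangMills.Theorems.AllWindowsColdBoxBoxHighLine

end
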